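import Literature.Geometry.Riemannian.MetricFlowFTotalBoundednessAux
import Literature.Geometry.Riemannian.MetricFlowFDistanceExtend
import Literature.Geometry.Riemannian.AlmostMonotoneSelection
import Mathlib.MeasureTheory.Measure.Lebesgue.Basic
import Mathlib.MeasureTheory.Measure.Regular
import HarnessLib

/-!
# Total boundedness of the `𝔽`-distance on sequences of `H`-concentrated metric flow pairs with
# compact time-slices (Bamler 2023, §7.3, Lemma 7.? (arXiv v1 Lemmas 164, 165) and the
# total-boundedness half of the proof of Thm. 7.4 (arXiv v1 Thm. 155))

R. Bamler, *Compactness theory of the space of super Ricci flows*, Invent. Math. 233 (2023), §7.3.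
Lemma 7.? (arXiv v1 Lemma 164): *"For every `ε > 0`, `H, V ≥ 0` and every function
`b : (0,1] → (0,1]` there is a `δ(ε, H, V, b) > 0` such that the following holds. Consider a
sequence of metric flow pairs `(𝒳^i, (μ^i_t)_{t ∈ I})` representing classes in
`𝔽^I_I(H, V, b, r)` … Let `I₀ ⊂ I₁ ⊂ I` be subsets such that the following holds: `I₀` is finite.
For any `t ∈ I₁` there is a minimal `t' ∈ I₀ ∩ [t, t + δr²]` and for this `t'` we have
`∫∫ d^i_{t'} dμ^i_{t'} dμ^i_{t'} − ∫∫ d^i_t dμ^i_t dμ^i_t ≤ δ r` for all `i`. `|I ∖ I₁| ≤ (εr)²`.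
Then, after passing to a subsequence, we have `d^{I₁}_𝔽((𝒳^i, (μ^i_t)), (𝒳^j, (μ^j_t))) ≤ ε r`
for all `i, j`."* Lemma 7.? (arXiv v1 Lemma 165): *"… Then there is a subsequence such that
for any `t ∈ I` the following limit exists `D(t) := lim_{i→∞} ∫∫ d^i_t dμ^i_t dμ^i_t < ∞`.
Moreover, … `D(t)` is continuous on the complement of a countable subset and the following holds.
Let `J ⊂ I` be a compact subset such that the restriction `D|_J` is continuous and `ε > 0`. Then
there is a subsequence such that `d^J_𝔽((𝒳^i, (μ^i_t)), (𝒳^j, (μ^j_t))) ≤ |I ∖ J|^{1/2} + ε`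
for all `i, j`."* Proof of Thm. 7.4 (arXiv v1 Thm. 155), total boundedness: *"By Lemma [165] we
may pass to a subsequence such that the limit (7.21) exists for all `t ∈ I` and it remains to
show that there is a compact subset `J' ⊂ I` with the property that `D|_{J ∪ J'}` is continuous
and `|I ∖ (J ∪ J')| < (εr)²`. Since `D` is continuous almost everywhere, we can use Lemma [basic
measure theory] to find [it]."*

This file proves the resulting TOTAL BOUNDEDNESS statement for `J = ∅`, `r = 1`, metric flow pairs
over `I = [a, T]` defined over `(a, T)` with `Var(μ_t) ≤ C` and COMPACT time-slices (the class of
the pairs of Ricci flows on closed manifolds; compactness replaces the mass-distribution bound `b`,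
cf. `MetricFlowFDistanceExtend.lean`), MODULO the finite-time subconvergence Lemma 7.? (arXiv v1
Lemma 161), taken as the hypothesis `h161` (proved elsewhere in the tree): every such sequence has,
for every `ε > 0`, a subsequence all of whose mutual `d_𝔽`-distances are `≤ ε`
(`MetricFlowPair.totalBoundedness_of_finite_subconvergence`). The proof is the printed one:
(1) the functions `D_i(t) = ∫∫ d^i_t dμ^i_t dμ^i_t` are bounded by `√V` and almost monotone
(`MetricFlowFTotalBoundednessAux.lean`), so a subsequence converges at every time to a limit `D`
continuous off a countable set `S` (`exists_subseq_tendsto_of_sub_sqrt_le`, Lemma 165, first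
part); (2) a compact `K ⊆ (a, T − ε') ∖ S` with `|[a, T] ∖ K| ≤ ε²` (inner regularity), a uniform
modulus of continuity of `D` along `K`, and a finite two-sided grid `I₀ ⊆ (a, T)` give, for large
`i` (convergence at the finitely many grid points) and every `t ∈ K`, the near-future estimate
`D_i(t') − D_i(t) ≤ 2√(Hh) + 4δ' ≤ δ` at the minimal grid point `t' > t` (Lemma 165, second part);
(3) Lemma 161 (`h161`) makes a further subsequence Cauchy within one correspondence over `I₀`, and
(4) Lemma 160 (`exists_correspondence_extend_of_finite`) extends the estimate to `I₁ = K ∪ I₀`,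
whence `d_𝔽 ≤ ε` over `[a, T]` with the exceptional set `[a, T] ∖ I₁` (Lemma 164).

## References

* R. H. Bamler, *Compactness theory of the space of super Ricci flows*, Invent. Math. 233 (2023),
  1121–1277 (arXiv:2008.09298), §7.3, Lemma 7.? (arXiv v1 Lemmas 164, 165), proof of Thm. 7.4
  (arXiv v1 Thm. 155); §7.2 Lemma 7.? (arXiv v1 Lemmas 160, 161). [Bamler2023]
-/

noncomputable section

open Set MeasureTheory Filter TopologicalSpace Function
open scoped Topology ENNReal NNReal

namespace Literature.Geometry.Riemannian

/-! ### Folklore tools: a large compact set of continuity points, a uniform modulus, a grid -/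

/-- **A compact subset of `(a, T − ε') ∖ S` of almost full measure in `[a, T]`** for a countable
`S` (Bamler 2023, §7.3, proof of Thm. 7.4: "we can use Lemma [basic measure theory] to find a
compact subset `J' ⊂ I` consisting only of points where `D` is continuous that satisfies
`|I ∖ J'| < (εr)²`"; inner regularity of Lebesgue measure, `|S| = 0`,
`[a, T] ∖ (a, T − ε') ⊆ {a} ∪ [T − ε', T]`). [folklore] -/
theorem exists_isCompact_volume_Icc_diff_le {a T ε' η : ℝ} {S : Set ℝ} (hS : S.Countable)
    (hε' : 0 ≤ ε') (hη : 0 < η) :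
    ∃ K : Set ℝ, IsCompact K ∧ K ⊆ Ioo a (T - ε') \ S ∧
      volume (Icc a T \ K) ≤ ENNReal.ofReal (ε' + η) := by
  set G : Set ℝ := Ioo a (T - ε') \ S with hG
  have hGm : MeasurableSet G := measurableSet_Ioo.diff hS.measurableSet
  have hGfin : volume G ≠ ∞ :=
    ne_top_of_le_ne_top (measure_Ioo_lt_top (a := a) (b := T - ε')).ne (measure_mono sdiff_subset)
  obtain ⟨K, hKG, hK, hKvol⟩ :=
    hGm.exists_isCompact_sdiff_lt hGfin (ENNReal.ofReal_pos.2 hη).ne'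
  refine ⟨K, hK, hKG, ?_⟩
  have h1 : Icc a T \ K ⊆ (Icc a T \ G) ∪ (G \ K) := by
    intro x hx
    by_cases hxG : x ∈ G
    · exact Or.inr ⟨hxG, hx.2⟩
    · exact Or.inl ⟨hx.1, hxG⟩
  have h2 : Icc a T \ G ⊆ ({a} ∪ Icc (T - ε') T) ∪ S := by
    intro x hx
    by_cases hxS : x ∈ S
    · exact Or.inr hxS
    · have hx' : x ∉ Ioo a (T - ε') := fun h ↦ hx.2 ⟨h, hxS⟩
      rcases eq_or_lt_of_le hx.1.1 with h | h
      · exact Or.inl (Or.inl h.symm)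
      · exact Or.inl (Or.inr ⟨not_lt.1 (fun h' ↦ hx' ⟨h, h'⟩), hx.1.2⟩)
  have h3 : volume (Icc a T \ G) ≤ ENNReal.ofReal ε' := by
    refine (measure_mono h2).trans ((measure_union_le _ _).trans ?_)
    rw [hS.measure_zero, add_zero]
    refine (measure_union_le _ _).trans ?_
    rw [Real.volume_singleton, zero_add, Real.volume_Icc]
    exact ENNReal.ofReal_le_ofReal (by linarith)
  calc volume (Icc a T \ K) ≤ volume (Icc a T \ G) + volume (G \ K) :=
        (measure_mono h1).trans (measure_union_le _ _)
    _ ≤ ENNReal.ofReal ε' + ENNReal.ofReal η := add_le_add h3 hKvol.le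
    _ = ENNReal.ofReal (ε' + η) := (ENNReal.ofReal_add hε' hη.le).symm

/-- **A uniform modulus of continuity along a compact set of continuity points** (the covering step
of Bamler 2023, proof of Lemma 165: "For any `t ∈ J` there is a compact interval `t ∈ I_t ⊂ I`
that is a neighborhood of `t` in `I` and that satisfies `|I_t| ≤ δ`, `osc_{I_t ∩ J} D ≤ δ`. By
compactness, `J` is covered by a finite number of these intervals"): if `f` is continuous within
`A` at every point of a compact `K ⊆ A`, then for `δ' > 0` there is `θ > 0` with
`|f t' − f t| < δ'` for all `t ∈ K`, `t' ∈ A`, `|t' − t| < θ` (Lebesgue number lemma). [folklore] -/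
theorem exists_forall_dist_lt_of_continuousWithinAt {K A : Set ℝ} (hK : IsCompact K) (hKA : K ⊆ A)
    {f : ℝ → ℝ} (hf : ∀ t ∈ K, ContinuousWithinAt f A t) {δ' : ℝ} (hδ' : 0 < δ') :
    ∃ θ > 0, ∀ t ∈ K, ∀ t' ∈ A, dist t' t < θ → dist (f t') (f t) < δ' := by
  have hr : ∀ p : K, ∃ r > 0, ∀ x ∈ A, dist x p < r → dist (f x) (f p) < δ' / 2 := fun p ↦
    Metric.continuousWithinAt_iff.1 (hf p p.2) (δ' / 2) (half_pos hδ')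
  choose r hr0 hr using hr
  obtain ⟨θ, hθ, hθc⟩ := lebesgue_number_lemma_of_metric hK
    (c := fun p : K ↦ Metric.ball (p : ℝ) (r p))
    (fun _ ↦ Metric.isOpen_ball) (fun t ht ↦ mem_iUnion.2 ⟨⟨t, ht⟩, Metric.mem_ball_self (hr0 _)⟩)
  refine ⟨θ, hθ, fun t ht t' ht' hd ↦ ?_⟩
  obtain ⟨p, hp⟩ := hθc t ht
  have h1 : dist (f t') (f p) < δ' / 2 := hr p t' ht' (hp (Metric.mem_ball.2 hd))
  have h2 : dist (f t) (f p) < δ' / 2 := hr p t (hKA ht) (hp (Metric.mem_ball_self hθ))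
  calc dist (f t') (f t) ≤ dist (f t') (f p) + dist (f t) (f p) := dist_triangle_right _ _ _
    _ < δ' / 2 + δ' / 2 := add_lt_add h1 h2
    _ = δ' := add_halves δ'

/-- **A finite two-sided grid** (Bamler 2023, proof of Lemma 165: "So there is a finite subset
`I₀ ⊂ I` such that for any `t ∈ J` there are `t'₁, t'₂ ∈ I₀` such that `t'₁ ≤ t ≤ t'₂`,
`t'₂ − t'₁ ≤ δ`"): for a compact `K ⊆ (a, T)` and `h > 0` there is a finite `I₀ ⊆ (a, T)` such that
every `t ∈ K` lies strictly between two points of `I₀` at distance `< h` (a finite subcover of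
the cover of `K` by the intervals `(x − η_x, x + η_x)`, `x ∈ K`). [folklore] -/
theorem exists_finset_two_sided_grid {K : Set ℝ} (hK : IsCompact K) {a T h : ℝ}
    (hKsub : K ⊆ Ioo a T) (hh : 0 < h) :
    ∃ I₀ : Finset ℝ, (↑I₀ : Set ℝ) ⊆ Ioo a T ∧
      ∀ t ∈ K, ∃ p ∈ I₀, ∃ q ∈ I₀, p < t ∧ t < q ∧ q - p < h := by
  classical
  set η : ℝ → ℝ := fun x ↦ min (h / 3) (min ((x - a) / 2) ((T - x) / 2)) with hη
  have hη0 : ∀ x ∈ K, 0 < η x := fun x hx ↦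
    lt_min (by positivity) (lt_min (by linarith [(hKsub hx).1]) (by linarith [(hKsub hx).2]))
  obtain ⟨F, hFK, hFcov⟩ := hK.elim_nhds_subcover (fun x ↦ Ioo (x - η x) (x + η x))
    fun x hx ↦ Ioo_mem_nhds (by linarith [hη0 x hx]) (by linarith [hη0 x hx])
  refine ⟨F.image (fun x ↦ x - η x) ∪ F.image (fun x ↦ x + η x), ?_, fun t ht ↦ ?_⟩
  · intro y hy
    simp only [Finset.coe_union, Finset.coe_image, mem_union, mem_image, Finset.mem_coe] at hy
    rcases hy with ⟨x, hx, rfl⟩ | ⟨x, hx, rfl⟩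
    · have h1 : η x ≤ (x - a) / 2 := (min_le_right _ _).trans (min_le_left _ _)
      exact ⟨by linarith [(hKsub (hFK x hx)).1],
        by linarith [hη0 x (hFK x hx), (hKsub (hFK x hx)).2]⟩
    · have h1 : η x ≤ (T - x) / 2 := (min_le_right _ _).trans (min_le_right _ _)
      exact ⟨by linarith [hη0 x (hFK x hx), (hKsub (hFK x hx)).1],
        by linarith [(hKsub (hFK x hx)).2]⟩
  · have ht' := hFcov ht
    simp only [mem_iUnion, exists_prop] at ht'
    obtain ⟨x, hx, htx⟩ := ht'
    have h1 : η x ≤ h / 3 := min_le_left _ _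
    refine ⟨x - η x, Finset.mem_union_left _ (Finset.mem_image_of_mem _ hx), x + η x,
      Finset.mem_union_right _ (Finset.mem_image_of_mem _ hx), htx.1, htx.2, by linarith⟩

/-- **The three-line estimate of the proof of Lemma 165** (Bamler 2023, §7.3): if the `D_i` are
almost monotone (`D_i(s) − √(H(t − s)) ≤ D_i(t)` for `s ≤ t`), `|D_i − D| ≤ δ'` at the grid points
`p < t < q` with `q − p < h`, and `|D(t') − D(t)| < δ'` for `t' ∈ {p, q}` (continuity of `D` at
`t`), then for every `t'` with `t < t' ≤ q` — in particular the minimal grid point after `t` —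
`D_i(t') ≤ D_i(t) + 2√(Hh) + 4δ'` ("`D_i(t') − D_i(t) ≤ D_i(t'₂) − D_i(t) + √(Hδ) ≤ 2√(Hδ) + 3δ`").
[cite: Bamler2023, §7.3, Lemma 7.? (arXiv v1 Lemma 165), proof] -/
theorem near_future_estimate {H h δ' : ℝ} (hH : 0 ≤ H) {Di D : ℝ → ℝ}
    (hmono : ∀ s t, s ≤ t → Di s - Real.sqrt (H * (t - s)) ≤ Di t) {p q t t' : ℝ}
    (hpt : p ≤ t) (htt' : t ≤ t') (ht'q : t' ≤ q) (hqp : q - p ≤ h)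
    (hp : |Di p - D p| ≤ δ') (hq : |Di q - D q| ≤ δ') (hDp : |D p - D t| ≤ δ')
    (hDq : |D q - D t| ≤ δ') : Di t' ≤ Di t + (2 * Real.sqrt (H * h) + 4 * δ') := by
  have h1 := hmono p t hpt
  have h2 := hmono t' q ht'q
  have h3 : Real.sqrt (H * (t - p)) ≤ Real.sqrt (H * h) :=
    Real.sqrt_le_sqrt (mul_le_mul_of_nonneg_left (by linarith) hH)
  have h4 : Real.sqrt (H * (q - t')) ≤ Real.sqrt (H * h) :=
    Real.sqrt_le_sqrt (mul_le_mul_of_nonneg_left (by linarith) hH)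
  rw [abs_le] at hp hq hDp hDq
  linarith [hp.1, hp.2, hq.1, hq.2, hDp.1, hDp.2, hDq.1, hDq.2]

/-! ### Total boundedness -/

namespace MetricFlowPair

open MetricFlow

/-- **Bamler 2023, §7.3: total boundedness of `d_𝔽` on `H`-concentrated metric flow pairs over
`[a, T]` with bounded variances and compact time-slices (Lemmas 7.? = arXiv v1 Lemmas 164, 165 and
the total-boundedness half of the proof of Thm. 7.4), modulo the finite-time subconvergence Lemma
(arXiv v1 Lemma 161) `h161`.** For `H ≥ 0`, `a < T` and a sequence `P` of `H`-concentrated metric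
flow pairs over `[a, T]` defined over `(a, T)` with `Var(μ_t) ≤ C` and compact time-slices, every
`ε > 0` admits a subsequence `φ` with `d_𝔽(P (φ i), P (φ j)) ≤ ε` for all `i, j`. Proof as printed:
the limit `D` of the average distances `D_i` along a subsequence (Lemma 165), a compact set `K` of
continuity points of `D` with `|[a, T] ∖ K| ≤ ε²`, a finite grid `I₀` and the near-future estimate
`D_i(t') − D_i(t) ≤ δ` on `K` for large `i`, subconvergence within a correspondence over `I₀`
(`h161`), extension to `K ∪ I₀` (Lemma 160) and to `[a, T]` (Lemma 164).
[cite: Bamler2023, §7.3, Lemma 7.? (arXiv v1 Lemmas 164, 165), proof of Thm 7.4] -/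
theorem totalBoundedness_of_finite_subconvergence
    (h161 : ∀ {a T H V : ℝ}, 0 ≤ H → 0 ≤ V → ∀ (P : ℕ → MetricFlowPair.{0} (Icc a T)),
      (∀ n, (P n).flow.IsHConcentrated H) → (∀ n, Ioo a T ⊆ (P n).I') →
      (∀ n (t : (P n).I'), variance ((P n).μ t) ((P n).μ t) ≤ ENNReal.ofReal V) →
      (∀ n (t : (P n).I'), CompactSpace ((P n).flow.Slice t)) →
      ∀ (I₀ : Finset ℝ), (↑I₀ : Set ℝ) ⊆ Ioo a T →
      ∃ φ : ℕ → ℕ, StrictMono φ ∧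
        ∃ ℭ₀ : FamilyCorrespondence (fun n ↦ (P (φ n)).flow) (↑I₀ : Set ℝ),
          ℭ₀.FullyDefinedOver ↑I₀ ∧
          ∀ ε : ℝ, 0 < ε → ∃ N, ∀ i ≥ N, ∀ j ≥ N,
            FDistAdmissibleWith (P (φ i)) (P (φ j)) (ℭ₀.pair i j) ∅ ↑I₀ ε)
    (H C a T : ℝ) (hH : 0 ≤ H) (haT : a < T) (P : ℕ → MetricFlowPair.{0} (Icc a T))
    (hP : ∀ n, (P n).flow.IsHConcentrated H) (hI : ∀ n, Ioo a T ⊆ (P n).I')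
    (hvar : ∀ n (t : (P n).I'), variance ((P n).μ t) ((P n).μ t) ≤ ENNReal.ofReal C)
    (hcpt : ∀ n (t : (P n).I'), CompactSpace ((P n).flow.Slice t))
    (ε : ℝ≥0∞) (hε : 0 < ε) :
    ∃ φ : ℕ → ℕ, StrictMono φ ∧ ∀ i j, fDist ∅ (P (φ i)) (P (φ j)) ≤ ε := by
  classical
  -- Step 0: `ε = ∞` is trivial; otherwise work with the real radius `ρ := ε.toReal`
  rcases eq_or_ne ε ∞ with hεtop | hεtop
  · exact ⟨id, strictMono_id, fun i j ↦ hεtop ▸ le_top⟩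
  have _haT := haT
  set ρ : ℝ := ε.toReal with hρdef
  have hρ : 0 < ρ := ENNReal.toReal_pos hε.ne' hεtop
  have hρε : ENNReal.ofReal ρ = ε := ENNReal.ofReal_toReal hεtop
  -- the variance bound `V := max C 0 ≥ 0`
  set V : ℝ := max C 0 with hVdef
  have hV : 0 ≤ V := le_max_right _ _
  have hvarV : ∀ n (t : (P n).I'), variance ((P n).μ t) ((P n).μ t) ≤ ENNReal.ofReal V :=
    fun n t ↦ (hvar n t).trans (ENNReal.ofReal_le_ofReal (le_max_left _ _))
  -- the radii: `ε' ≤ ρ` and `ε' + ρ² / 2 ≤ ρ²`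
  set ε' : ℝ := min ρ (ρ ^ 2 / 2) with hε'def
  have hε' : 0 < ε' := lt_min hρ (by positivity)
  have hε'ρ : ε' ≤ ρ := min_le_left _ _
  have hε'ρ2 : ε' + ρ ^ 2 / 2 ≤ ρ ^ 2 := by linarith [min_le_right ρ (ρ ^ 2 / 2)]
  -- Lemma 160's `δ = δ(H, V, ε')`
  obtain ⟨δ, hδ, h160⟩ := exists_correspondence_extend_of_finite H V ε' hH hV hε'
  -- Step 1 (Lemma 165, first part): the functions `D_i` and their subsequential limit `D`
  set D : ℕ → ℝ → ℝ := fun n ↦ (P n).avgDistReal (hI n) (Real.sqrt V) with hDdef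
  obtain ⟨φ₀, hφ₀, Dlim, htend, -, -, hcount⟩ := exists_subseq_tendsto_of_sub_sqrt_le hH D
    (fun n t _ ↦ (P n).avgDistReal_mem_Icc hV (hvarV n) t)
    (fun n s _ t _ hst ↦ (P n).avgDistReal_sub_sqrt_le hH (hP n) hV (hvarV n) (hcpt n) hst)
  -- Step 2: a compact set `K ⊆ (a, T - ε') ∖ S` of continuity points, `|[a, T] ∖ K| ≤ ρ²`
  obtain ⟨K, hK, hKsub, hKvol⟩ := exists_isCompact_volume_Icc_diff_le (a := a) (T := T) hcount
    hε'.le (half_pos (pow_pos hρ 2))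
  have hKIoo : K ⊆ Ioo a T := fun t ht ↦ ⟨(hKsub ht).1.1, (hKsub ht).1.2.trans (sub_lt_self T hε')⟩
  have hKIcc : K ⊆ Icc a T := fun t ht ↦ Ioo_subset_Icc_self (hKIoo ht)
  have hKcont : ∀ t ∈ K, ContinuousWithinAt Dlim (Icc a T) t := fun t ht ↦
    by_contra fun h ↦ (hKsub ht).2 ⟨hKIcc ht, h⟩
  -- Step 3: the modulus `θ` for `δ' := δ / 8`, the mesh `h`, the finite grid `I₀ ⊆ (a, T)`
  have hδ' : 0 < δ / 8 := by positivity
  obtain ⟨θ, hθ, hθc⟩ := exists_forall_dist_lt_of_continuousWithinAt hK hKIcc hKcont hδ'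
  have hH1 : 0 < H + 1 := by linarith
  set h : ℝ := min θ (min (δ ^ 2 / (16 * (H + 1))) δ) with hhdef
  have hh : 0 < h := lt_min hθ (lt_min (by positivity) hδ)
  have hhθ : h ≤ θ := min_le_left _ _
  have hhδ : h ≤ δ := (min_le_right _ _).trans (min_le_right _ _)
  have hsqrt : 2 * Real.sqrt (H * h) + 4 * (δ / 8) ≤ δ := by
    have h1 : h ≤ δ ^ 2 / (16 * (H + 1)) := (min_le_right _ _).trans (min_le_left _ _)
    have h2 : H * h ≤ (δ / 4) ^ 2 := by
      have e1 : H * h ≤ (H + 1) * h := by nlinarith [hh.le]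
      have e2 : (H + 1) * h ≤ (H + 1) * (δ ^ 2 / (16 * (H + 1))) :=
        mul_le_mul_of_nonneg_left h1 hH1.le
      have e3 : (H + 1) * (δ ^ 2 / (16 * (H + 1))) = (δ / 4) ^ 2 := by
        field_simp
        ring
      linarith
    have h3 : Real.sqrt (H * h) ≤ δ / 4 := by
      rw [← Real.sqrt_sq (by positivity : (0 : ℝ) ≤ δ / 4)]
      exact Real.sqrt_le_sqrt h2
    linarith
  obtain ⟨I₀, hI₀, hgrid⟩ := exists_finset_two_sided_grid hK hKIoo hh
  have hI₀Icc : (↑I₀ : Set ℝ) ⊆ Icc a T := hI₀.trans Ioo_subset_Icc_self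
  -- Step 4: along `φ₀`, eventually `|D_i − D| < δ / 8` on the finite grid
  have hev : ∀ᶠ i in atTop, ∀ p ∈ I₀, dist (D (φ₀ i) p) (Dlim p) < δ / 8 :=
    (eventually_all_finset I₀).2 fun p hp ↦ Metric.tendsto_nhds.1 (htend p (hI₀Icc hp)) _ hδ'
  obtain ⟨N₁, hN₁⟩ := eventually_atTop.1 hev
  -- the near-future estimate at the minimal grid point after `t ∈ K` (Lemma 165, second part)
  have hclaim : ∀ t ∈ K, ∃ t' ∈ I₀, t < t' ∧ t' ≤ t + δ ∧ (∀ t'' ∈ I₀, t < t'' → t' ≤ t'') ∧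
      ∀ n, N₁ ≤ n → D (φ₀ n) t' ≤ D (φ₀ n) t + δ := by
    intro t htK
    obtain ⟨p, hp, q, hq, hpt, htq, hqp⟩ := hgrid t htK
    have hne : (I₀.filter fun x ↦ t < x).Nonempty := ⟨q, Finset.mem_filter.2 ⟨hq, htq⟩⟩
    have ht'mem : (I₀.filter fun x ↦ t < x).min' hne ∈ I₀.filter fun x ↦ t < x :=
      Finset.min'_mem _ _
    have ht'I₀ := (Finset.mem_filter.1 ht'mem).1
    have htt' : t < (I₀.filter fun x ↦ t < x).min' hne := (Finset.mem_filter.1 ht'mem).2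
    have ht'q : (I₀.filter fun x ↦ t < x).min' hne ≤ q :=
      Finset.min'_le _ _ (Finset.mem_filter.2 ⟨hq, htq⟩)
    refine ⟨_, ht'I₀, htt', by linarith, fun t'' ht'' hlt ↦
      Finset.min'_le _ _ (Finset.mem_filter.2 ⟨ht'', hlt⟩), fun n hn ↦ ?_⟩
    have e1 : |D (φ₀ n) p - Dlim p| ≤ δ / 8 := by
      have e := hN₁ n hn p hp
      rw [Real.dist_eq] at e
      exact e.le
    have e2 : |D (φ₀ n) q - Dlim q| ≤ δ / 8 := by
      have e := hN₁ n hn q hq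
      rw [Real.dist_eq] at e
      exact e.le
    have e3 : |Dlim p - Dlim t| ≤ δ / 8 := by
      have e := hθc t htK p (hI₀Icc hp)
        (by rw [Real.dist_eq, abs_sub_comm, abs_of_pos (sub_pos.2 hpt)]; linarith)
      rw [Real.dist_eq] at e
      exact e.le
    have e4 : |Dlim q - Dlim t| ≤ δ / 8 := by
      have e := hθc t htK q (hI₀Icc hq) (by rw [Real.dist_eq, abs_of_pos (sub_pos.2 htq)]; linarith)
      rw [Real.dist_eq] at e
      exact e.le
    have e := near_future_estimate hH (Di := D (φ₀ n)) (D := Dlim)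
      (fun s u hsu ↦ (P (φ₀ n)).avgDistReal_sub_sqrt_le hH (hP _) hV (hvarV _) (hcpt _) hsu)
      hpt.le htt'.le ht'q hqp.le e1 e2 e3 e4
    linarith [hsqrt]
  -- Step 5 (Lemma 161): subconvergence within a correspondence over the grid, `δ`-close
  obtain ⟨φ₁, hφ₁, ℭ₀, -, hC⟩ := h161 hH hV (fun n ↦ P (φ₀ (N₁ + n))) (fun n ↦ hP _)
    (fun n ↦ hI _) (fun n ↦ hvarV _) (fun n ↦ hcpt _) I₀ hI₀
  obtain ⟨N₂, hN₂⟩ := hC δ hδ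
  -- the final subsequence `ψ k := φ₀ (N₁ + φ₁ (N₂ + k))`
  refine ⟨fun k ↦ φ₀ (N₁ + φ₁ (N₂ + k)),
    fun i j hij ↦ hφ₀ (Nat.add_lt_add_left (hφ₁ (Nat.add_lt_add_left hij N₂)) N₁), fun i j ↦ ?_⟩
  show fDist ∅ (P (φ₀ (N₁ + φ₁ (N₂ + i)))) (P (φ₀ (N₁ + φ₁ (N₂ + j)))) ≤ ε
  -- Step 6 (Lemma 160 over `I₁ := K ∪ I₀`, then Lemma 164: extension to `[a, T]`)
  set I₁ : Set ℝ := K ∪ ↑I₀ with hI₁def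
  have hI₁m : MeasurableSet I₁ := hK.measurableSet.union I₀.finite_toSet.measurableSet
  have hI₀I₁ : (↑I₀ : Set ℝ) ⊆ I₁ := subset_union_right
  have hI₁Ioo : I₁ ⊆ Ioo a T := union_subset hKIoo hI₀
  have hvolI₁ : volume (Icc a T \ I₁) ≤ ENNReal.ofReal (ρ ^ 2) :=
    (measure_mono (sdiff_subset_sdiff_right subset_union_left)).trans
      (hKvol.trans (ENNReal.ofReal_le_ofReal hε'ρ2))
  have hadm : FDistAdmissibleWith (P (φ₀ (N₁ + φ₁ (N₂ + i)))) (P (φ₀ (N₁ + φ₁ (N₂ + j))))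
      (ℭ₀.pair (N₂ + i) (N₂ + j)) ∅ ↑I₀ δ :=
    hN₂ (N₂ + i) (Nat.le_add_right _ _) (N₂ + j) (Nat.le_add_right _ _)
  obtain ⟨ℭ, hℭ⟩ : ∃ ℭ : Correspondence₂ (P (φ₀ (N₁ + φ₁ (N₂ + i)))).flow
      (P (φ₀ (N₁ + φ₁ (N₂ + j)))).flow I₁,
      FDistAdmissibleWith (P (φ₀ (N₁ + φ₁ (N₂ + i)))) (P (φ₀ (N₁ + φ₁ (N₂ + j)))) ℭ ∅ I₁ ε' := by
    refine h160 (P (φ₀ (N₁ + φ₁ (N₂ + i)))) (P (φ₀ (N₁ + φ₁ (N₂ + j)))) (hP _) (hP _) (hI _)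
      (hI _) (hvarV _) (hvarV _) (hcpt _) (hcpt _) I₀ I₁ (ℭ₀.pair (N₂ + i) (N₂ + j)) hadm hI₁m
      hI₀I₁ hI₁Ioo (fun t ht ↦ ?_)
    -- the near-future hypothesis of Lemma 160 at `t ∈ I₁ ∖ I₀ = K ∖ I₀`
    have htK : t ∈ K := ht.1.resolve_right ht.2
    obtain ⟨t', ht'I₀, htt', ht'δ, hmin, hDest⟩ := hclaim t htK
    have ht'Ioo : t' ∈ Ioo a T := hI₀ ht'I₀
    refine ⟨by linarith [(hKsub htK).1.2], t', ht'I₀, htt', ht'δ, hmin, ?_, ?_⟩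
    · exact (P _).averageEDist_le_add_of_avgDistReal_le hV (hvarV _) ht'Ioo (hKIoo htK) hδ.le
        (hDest _ (Nat.le_add_right _ _))
    · exact (P _).averageEDist_le_add_of_avgDistReal_le hV (hvarV _) ht'Ioo (hKIoo htK) hδ.le
        (hDest _ (Nat.le_add_right _ _))
  calc fDist ∅ (P (φ₀ (N₁ + φ₁ (N₂ + i)))) (P (φ₀ (N₁ + φ₁ (N₂ + j)))) ≤ ENNReal.ofReal ρ :=
        fDist_empty_le_of_fDistAdmissibleWith hℭ (hI₁Ioo.trans Ioo_subset_Icc_self)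
          measurableSet_Icc hI₁m hε'ρ hvolI₁
    _ = ε := hρε

end MetricFlowPair

end Literature.Geometry.Riemannian

end
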